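import Summits.QuantumAdvantage.QuantumAdvantage.Theorems.SpreadDialNandRing
import Literature.Computability.MetaComplexity.ModqImmunity
import Literature.Computability.MetaComplexity.SmolenskyCorrelationRestrict
import HarnessLib

/-!
# HollowDial — part 1/2: the HOLLOWNESS LAW (route-independent; support for item stmt-QuantumAdvantage-28375)

Cell decomp-qadv, seat lens-5 («finite range + asymptotic regime + bridge»), generation 14.  Land port of §0–§1c of the node
«HollowDial» (cell HOME/decomp-qadv-lens-5/g14/HollowDial.lean): the node's text VERBATIM, namespace renamed from the
Theses to the Theorems tree.  This part imports NO route file.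

§0 block parities `bpar T y = [⊕_{i∈T} y_i = 1]`, the block extension operator `ext` (substitution of variables:
`comp_ext_mem_lowDeg`, `card_filter_ext`), the `𝔽₃` level-set indicator `ind3`.
§1 HOLLOWNESS, relative and iterated: `hollow_block` — over a field with `2 ≠ 0`, a degree-`D` function with `2D < |T|`
that vanishes at the inputs of ONE `T`-parity class of a `T`-rewriting-stable family vanishes on the whole family (the
absolute law is the tree's `Smolensky.eq_zero_of_lowDeg_of_support_subset_modClass`, Beck–Li 2013 Thm 3.4 = immunity /
one-sided degree `≥ n/2` of `MOD₂`); `hollow_class`; `hollow_oddSub` — iteration over pairwise disjoint blocks: a degree-`D`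
function (`2D < min_j |T_j|`) vanishing on the all-odd coset `A_T` is zero.
§1c consequences over `𝔽₃` (victim-free, TRUE laws for the located hard cell of 28375 = one foreign ring betting on the
NAND of heavy disjoint block parities, `Theorems.TameDial.exists_nand_ring`): no nonempty algebraic level set `{G = 1}`,
`deg G < min|T_j|/4`, inside a heavy parity class / a parity-NAND event / a hidden loss set (`levelSet_not_subset_parClass`,
`levelSet_not_subset_nandEv`, `hiddenLoss_no_levelSet`); no subcube of codimension `< min|T_j|/2` inside them
(`cylinder_not_subset_parClass`, `cylinder_not_subset_nandEv`, `hiddenLoss_no_cylinder`); packaged for the g8 ring as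
`roughRing_hollow`.  These certify that the two engines of the programme — algebraic spread (30970, needs an inner
algebraic set) and cylinder/window restriction (g13, needs `≥ |T_j|/2` frozen bits per block) — are VOID on heavy blocks.
No `sorry`, no new axioms, no instances, no notation.
-/

set_option linter.style.longLine false
set_option linter.dupNamespace false

noncomputable section

open scoped Classical

namespace Summit.QuantumAdvantage.QuantumAdvantage.Theorems.HollowDial

open Finset
open Literature.Computability.MetaComplexity

variable {n : ℕ}

/-! ## §0 Vocabulary: block parities, the all-odd coset, the parity-NAND event -/

/-- the PARITY BIT of `y` on the block `T`: `⊕_{i ∈ T} y_i`. -/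
def bpar (T : Finset (Fin n)) (y : Fin n → Bool) : Bool :=
  decide ((T.filter fun i => y i = true).card % 2 = 1)

/-- the EXTENSION operator of a block `T`: overwrite `y` on `T` by the `|T|` free bits `x`. -/
def ext (T : Finset (Fin n)) (y : Fin n → Bool) (x : Fin T.card → Bool) : Fin n → Bool :=
  fun i => if h : i ∈ T then x (T.equivFin ⟨i, h⟩) else y i

/-- off the block the extension is `y`. -/
theorem ext_of_not_mem {T : Finset (Fin n)} (y : Fin n → Bool) (x : Fin T.card → Bool) {i : Fin n}
    (h : i ∉ T) : ext T y x i = y i := by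
  simp [ext, h]

/-- on the block the extension reads the free bits. -/
theorem ext_of_mem {T : Finset (Fin n)} (y : Fin n → Bool) (x : Fin T.card → Bool) {i : Fin n}
    (h : i ∈ T) : ext T y x i = x (T.equivFin ⟨i, h⟩) := by
  simp [ext, h]

/-- `y` is its own extension by its own `T`-bits. -/
theorem ext_self (T : Finset (Fin n)) (y : Fin n → Bool) :
    ext T y (fun j => y ((T.equivFin.symm j : T) : Fin n)) = y := by
  funext i
  by_cases h : i ∈ T
  · rw [ext_of_mem y _ h, Equiv.symm_apply_apply]
  · rw [ext_of_not_mem y _ h]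

/-- restriction to a block preserves the degree filtration (a substitution of variables). -/
theorem comp_ext_mem_lowDeg {F : Type*} [Field F] (T : Finset (Fin n)) (y : Fin n → Bool) {D : ℕ}
    {f : Smolensky.CubeFn F n} (hf : f ∈ Smolensky.lowDeg F n D) :
    (fun x => f (ext T y x)) ∈ Smolensky.lowDeg F T.card D := by
  refine Smolensky.comp_subst_mem_lowDeg (ext T y) (fun i => ?_) hf
  by_cases h : i ∈ T
  · exact Or.inr ⟨T.equivFin ⟨i, h⟩, fun x => ext_of_mem y x h⟩
  · exact Or.inl ⟨y i, fun x => ext_of_not_mem y x h⟩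

/-- the block parity of an extension is the full parity of the free bits. -/
theorem card_filter_ext (T : Finset (Fin n)) (y : Fin n → Bool) (x : Fin T.card → Bool) :
    (T.filter fun i => ext T y x i = true).card = (univ.filter fun j => x j = true).card := by
  symm
  refine Finset.card_bij (fun j _ => ((T.equivFin.symm j : T) : Fin n)) (fun j hj => ?_) (fun j₁ _ j₂ _ h => ?_)
    (fun i hi => ?_)
  · rw [mem_filter] at hj ⊢
    refine ⟨(T.equivFin.symm j).2, ?_⟩
    rw [ext_of_mem y x (T.equivFin.symm j).2]
    simpa using hj.2
  · exact T.equivFin.symm.injective (Subtype.ext h)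
  · rw [mem_filter] at hi
    refine ⟨T.equivFin ⟨i, hi.1⟩, ?_, by simp⟩
    rw [mem_filter]
    exact ⟨mem_univ _, by rw [← ext_of_mem y x hi.1]; exact hi.2⟩

/-- the block parity of an extension = the full parity of the free bits. -/
theorem bpar_ext (T : Finset (Fin n)) (y : Fin n → Bool) (x : Fin T.card → Bool) :
    bpar T (ext T y x) = decide ((univ.filter fun j => x j = true).card % 2 = 1) := by
  rw [bpar, card_filter_ext]

/-- off the block nothing changes: the parity of a DISJOINT block is untouched. -/
theorem bpar_ext_of_disjoint {T T' : Finset (Fin n)} (h : Disjoint T' T) (y : Fin n → Bool) (x : Fin T.card → Bool) :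
    bpar T' (ext T y x) = bpar T' y := by
  have hf : (T'.filter fun i => ext T y x i = true) = T'.filter fun i => y i = true :=
    filter_congr fun i hi => by rw [ext_of_not_mem y x (disjoint_left.1 h hi)]
  rw [bpar, bpar, hf]

/-! ## §1 HOLLOWNESS (one-sided degree of a block parity), relative and iterated

The law itself — a polynomial function of degree `D`, `2D < n`, over a field of characteristic `≠ 2`, supported
inside ONE parity class is zero — is the tree's `Smolensky.eq_zero_of_lowDeg_of_support_subset_modClass`
(Beck–Li 2013 Thm 3.4 = immunity of `MOD_2` is `≥ n/2`; Barrington–Beigel–Rudich 1994, Tsai 1996, Green 2000).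
New here: the RELATIVE BLOCK form (restrict to a block around each point) and its ITERATION over pairwise
disjoint blocks, which is what the parity-NAND rings of the located core need. -/

section Hollow

variable {F : Type*} [Field F]

/-- `-1 ≠ 1` in characteristic `≠ 2`. -/
theorem neg_one_ne_one_of_two_ne_zero (h2 : (2 : F) ≠ 0) : (-1 : F) ≠ 1 :=
  fun h => h2 (by linear_combination -h)

/-- ★ RELATIVE BLOCK HOLLOWNESS. `T` a block with `2D < |T|`, `f` of degree `≤ D`, `Q` a property of inputs
stable under rewriting the `T`-bits. If `f` vanishes at every `Q`-input of `T`-parity `e`, then `f` vanishes at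
EVERY `Q`-input. -/
theorem hollow_block (h2 : (2 : F) ≠ 0) {D : ℕ} {T : Finset (Fin n)} (hD : 2 * D < T.card)
    {f : Smolensky.CubeFn F n} (hf : f ∈ Smolensky.lowDeg F n D)
    (Q : (Fin n → Bool) → Prop) (hQ : ∀ y x, Q y → Q (ext T y x))
    (e : Bool) (hv : ∀ u, Q u → bpar T u = e → f u = 0) : ∀ u, Q u → f u = 0 := by
  intro y hy
  set g : Smolensky.CubeFn F T.card := fun x => f (ext T y x) with hgdef
  have hg : g ∈ Smolensky.lowDeg F T.card D := comp_ext_mem_lowDeg T y hf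
  have hsupp : ∀ x, g x ≠ 0 →
      (univ.filter fun j => x j = true).card % 2 = (if e = true then 0 else 1) % 2 := by
    intro x hx
    by_contra hne
    refine hx (hv _ (hQ y x hy) ?_)
    rw [bpar_ext]
    rcases Nat.mod_two_eq_zero_or_one (univ.filter fun j => x j = true).card with h0 | h1
    · cases e
      · simp [h0]
      · exact absurd (by simp [h0]) hne
    · cases e
      · exact absurd (by simp [h1]) hne
      · simp [h1]
  have hg0 : g = 0 :=
    Smolensky.eq_zero_of_lowDeg_of_support_subset_modClass (ω := (-1 : F)) (q := 2) two_pos (by norm_num)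
      (neg_one_ne_one_of_two_ne_zero h2) hD hg _ hsupp
  have := congrFun hg0 (fun j => y ((T.equivFin.symm j : T) : Fin n))
  simpa only [hgdef, ext_self, Pi.zero_apply] using this

/-- absolute form: supported inside one parity class of a block of size `> 2D` ⟹ zero. -/
theorem hollow_class (h2 : (2 : F) ≠ 0) {D : ℕ} {T : Finset (Fin n)} (hD : 2 * D < T.card)
    {f : Smolensky.CubeFn F n} (hf : f ∈ Smolensky.lowDeg F n D)
    (e : Bool) (hv : ∀ u, bpar T u = e → f u = 0) : f = 0 :=
  funext fun u => hollow_block h2 hD hf (fun _ => True) (fun _ _ _ => trivial) e (fun u _ hu => hv u hu) u trivial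

/-- ★ ITERATED HOLLOWNESS: pairwise disjoint blocks `T₁ … T_r`, each of size `> 2D`; a degree-`≤ D` function vanishing
on the ALL-ODD coset `{y : ⊕_{T_j} y = 1 ∀ j}` (codimension `r`, density `2^{-r}`) vanishes identically. -/
theorem hollow_oddSub (h2 : (2 : F) ≠ 0) {r : ℕ} {T : Fin r → Finset (Fin n)}
    (hdis : ∀ j j', j ≠ j' → Disjoint (T j) (T j')) {D : ℕ} (hD : ∀ j, 2 * D < (T j).card)
    {f : Smolensky.CubeFn F n} (hf : f ∈ Smolensky.lowDeg F n D)
    (hv : ∀ u, (∀ j, bpar (T j) u = true) → f u = 0) : f = 0 := by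
  have key : ∀ s, s ≤ r → ∀ u, (∀ j : Fin r, s ≤ j.val → bpar (T j) u = true) → f u = 0 := by
    intro s
    induction s with
    | zero => exact fun _ u hu => hv u fun j => hu j (Nat.zero_le _)
    | succ s ih =>
      intro hs
      have hs' : s < r := hs
      let js : Fin r := ⟨s, hs'⟩
      refine hollow_block h2 (hD js) hf (fun u => ∀ j : Fin r, s + 1 ≤ j.val → bpar (T j) u = true) ?_ true ?_
      · intro y x hy j hj
        have hne : j ≠ js := fun h => by subst h; simp [js] at hj
        rw [bpar_ext_of_disjoint (hdis j js hne)]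
        exact hy j hj
      · intro u hu hpar
        refine ih hs'.le u fun j hj => ?_
        by_cases h : j = js
        · subst h; exact hpar
        · exact hu j (by
            have : j.val ≠ s := fun h' => h (Fin.ext h')
            omega)
  funext u
  exact key r le_rfl u fun j hj => absurd hj (by omega)

end Hollow


/-! ## §1c Consequences over `𝔽₃`: algebraic level sets, cylinders, hidden losses -/

section Apps

open Literature.Computability.QuantumComplexity

/-- `2 ≠ 0` in `𝔽₃`. -/
private theorem two_ne_zero_zmod3 : (2 : ZMod 3) ≠ 0 := by decide

/-- the `𝔽₃` INDICATOR of the level set `{G = 1}`: `ind3 G = 2G² + 2G` (`= 1` iff `G = 1`, else `0`; degree doubles).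
(Same polynomial as the tree's `Theorems.CodimDial.ind`; restated here to keep this law route-independent.) -/
def ind3 (G : Smolensky.CubeFn (ZMod 3) n) : Smolensky.CubeFn (ZMod 3) n := (2 : ZMod 3) • (G * G) + (2 : ZMod 3) • G

/-- `ind3 G y = [G y = 1]`. -/
theorem ind3_apply (G : Smolensky.CubeFn (ZMod 3) n) (y : Fin n → Bool) : ind3 G y = if G y = 1 then 1 else 0 := by
  simp only [ind3, Pi.add_apply, Pi.smul_apply, Pi.mul_apply, smul_eq_mul]
  generalize G y = a
  revert a
  decide

/-- `deg ind3 G ≤ 2 deg G`. -/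
theorem ind3_mem_lowDeg {D : ℕ} {G : Smolensky.CubeFn (ZMod 3) n} (hG : G ∈ Smolensky.lowDeg (ZMod 3) n D) :
    ind3 G ∈ Smolensky.lowDeg (ZMod 3) n (D + D) :=
  Submodule.add_mem _ (Submodule.smul_mem _ (2 : ZMod 3) (Smolensky.mul_mem_lowDeg_add hG hG))
    (Submodule.smul_mem _ (2 : ZMod 3) (Smolensky.lowDeg_mono (Nat.le_add_right D D) hG))

/-- products with summed degrees. -/
theorem prod_mem_lowDeg_sum {ι : Type*} (s : Finset ι) (f : ι → Smolensky.CubeFn (ZMod 3) n) (d : ι → ℕ)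
    (hf : ∀ i ∈ s, f i ∈ Smolensky.lowDeg (ZMod 3) n (d i)) :
    ∏ i ∈ s, f i ∈ Smolensky.lowDeg (ZMod 3) n (∑ i ∈ s, d i) := by
  induction s using Finset.induction_on with
  | empty => simp only [Finset.prod_empty, Finset.sum_empty]; exact Smolensky.one_mem_lowDeg 0
  | insert a s ha ih =>
    rw [Finset.prod_insert ha, Finset.sum_insert ha]
    exact Smolensky.mul_mem_lowDeg_add (hf a (Finset.mem_insert_self _ _))
      (ih fun i hi => hf i (Finset.mem_insert_of_mem hi))

/-- (A′) a NONEMPTY `𝔽₃`-algebraic set `{G = 1}`, `deg G ≤ D`, never fits inside ONE parity class of a block of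
size `> 4D` (apply hollowness to the indicator `ind3 G` of degree `2D`). -/
theorem levelSet_not_subset_parClass {D : ℕ} {T : Finset (Fin n)} (hD : 4 * D < T.card)
    {G : Smolensky.CubeFn (ZMod 3) n} (hG : G ∈ Smolensky.lowDeg (ZMod 3) n D) (e : Bool)
    (h : ∀ y, G y = 1 → bpar T y = e) : ∀ y, G y ≠ 1 := by
  have h0 : ind3 G = 0 :=
    hollow_class two_ne_zero_zmod3 (D := D + D) (T := T) (by omega) (ind3_mem_lowDeg hG) (!e) fun u hu => by
      rw [ind3_apply]
      split_ifs with hG1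
      · have := h u hG1
        rw [hu] at this
        cases e <;> simp at this
      · rfl
  intro y hy
  have := congrFun h0 y
  rw [ind3_apply, if_pos hy] at this
  exact one_ne_zero this

/-- (A) pairwise disjoint blocks, each of size `> 4D`: a nonempty algebraic set `{G = 1}` (`deg G ≤ D`) never fits inside the
parity-NAND event `{y : ¬ ∀ j, ⊕_{T_j} y = 1}` — although that event has density `1 − 2^{-r}`. Sharpens the tree's
`spreadDial_noAlgebraicShadow3` (no DENSE inner algebraic core) to: no inner algebraic point at all below degree `min_j |T_j| / 4`. -/
theorem levelSet_not_subset_nandEv {r : ℕ} {T : Fin r → Finset (Fin n)}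
    (hdis : ∀ j j', j ≠ j' → Disjoint (T j) (T j')) {D : ℕ} (hD : ∀ j, 4 * D < (T j).card)
    {G : Smolensky.CubeFn (ZMod 3) n} (hG : G ∈ Smolensky.lowDeg (ZMod 3) n D)
    (h : ∀ y, G y = 1 → ¬ ∀ j, bpar (T j) y = true) : ∀ y, G y ≠ 1 := by
  have h0 : ind3 G = 0 :=
    hollow_oddSub two_ne_zero_zmod3 hdis (D := D + D) (fun j => by have := hD j; omega) (ind3_mem_lowDeg hG)
      fun u hu => by
        rw [ind3_apply]
        split_ifs with hG1
        · exact absurd hu (h u hG1)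
        · rfl
  intro y hy
  have := congrFun h0 y
  rw [ind3_apply, if_pos hy] at this
  exact one_ne_zero this

/-- the indicator of the cylinder (subcube) `{y : y_i = a_i ∀ i ∈ S}` of codimension `|S|`. -/
def cylFn (S : Finset (Fin n)) (a : Fin n → Bool) : Smolensky.CubeFn (ZMod 3) n :=
  fun y => if ∀ i ∈ S, y i = a i then 1 else 0

/-- the cylinder through `a` contains `a`. -/
theorem cylFn_apply_self (S : Finset (Fin n)) (a : Fin n → Bool) : cylFn S a a = 1 := by
  simp [cylFn]

/-- a literal `[y_i = b]` has degree `1`. -/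
theorem litFn_mem_lowDeg (i : Fin n) (b : Bool) :
    (fun y : Fin n → Bool => if y i = b then (1 : ZMod 3) else 0) ∈ Smolensky.lowDeg (ZMod 3) n 1 := by
  cases b
  · have hf : (fun y : Fin n → Bool => if y i = false then (1 : ZMod 3) else 0) = 1 - Smolensky.mono (ZMod 3) {i} := by
      funext y
      simp only [Pi.sub_apply, Pi.one_apply, Smolensky.mono_apply, Finset.mem_singleton, forall_eq]
      cases y i <;> simp
    rw [hf]
    exact Submodule.sub_mem _ (Smolensky.one_mem_lowDeg 1) (Smolensky.mono_mem_lowDeg (by simp))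
  · have hf : (fun y : Fin n → Bool => if y i = true then (1 : ZMod 3) else 0) = Smolensky.mono (ZMod 3) {i} := by
      funext y
      simp only [Smolensky.mono_apply, Finset.mem_singleton, forall_eq]
    rw [hf]
    exact Smolensky.mono_mem_lowDeg (by simp)

/-- a cylinder indicator is the product of its literals. -/
theorem cylFn_eq_prod (S : Finset (Fin n)) (a : Fin n → Bool) :
    cylFn S a = ∏ i ∈ S, (fun y : Fin n → Bool => if y i = a i then (1 : ZMod 3) else 0) := by
  funext y
  rw [cylFn, Finset.prod_apply, Finset.prod_boole]
  split_ifs <;> rfl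

/-- a cylinder of codimension `|S|` is algebraic of degree `|S|`. -/
theorem cylFn_mem_lowDeg (S : Finset (Fin n)) (a : Fin n → Bool) :
    cylFn S a ∈ Smolensky.lowDeg (ZMod 3) n S.card := by
  rw [cylFn_eq_prod]
  have := prod_mem_lowDeg_sum S (fun i => fun y : Fin n → Bool => if y i = a i then (1 : ZMod 3) else 0)
    (fun _ => 1) (fun i _ => litFn_mem_lowDeg i (a i))
  simpa using this

/-- (B) no cylinder of codimension `|S|` with `2|S| < |T_j|` (all `j`) fits inside the parity-NAND event of pairwise disjoint
blocks (freezing fewer than `|T_j|/2` bits never forces the event). -/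
theorem cylinder_not_subset_nandEv {r : ℕ} {T : Fin r → Finset (Fin n)}
    (hdis : ∀ j j', j ≠ j' → Disjoint (T j) (T j')) {S : Finset (Fin n)} (hS : ∀ j, 2 * S.card < (T j).card)
    (a : Fin n → Bool) : ¬ ∀ y, (∀ i ∈ S, y i = a i) → ¬ ∀ j, bpar (T j) y = true := by
  intro h
  have h0 : cylFn S a = 0 :=
    hollow_oddSub two_ne_zero_zmod3 hdis hS (cylFn_mem_lowDeg S a) fun u hu => by
      rw [cylFn]
      split_ifs with hc
      · exact absurd hu (h u hc)
      · rfl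
  have := congrFun h0 a
  rw [cylFn_apply_self] at this
  exact one_ne_zero this

/-- (B′) nor inside one parity class of a single block with `2|S| < |T|`. -/
theorem cylinder_not_subset_parClass {S T : Finset (Fin n)} (hS : 2 * S.card < T.card) (a : Fin n → Bool) (e : Bool) :
    ¬ ∀ y, (∀ i ∈ S, y i = a i) → bpar T y = e := by
  intro h
  have h0 : cylFn S a = 0 :=
    hollow_class two_ne_zero_zmod3 hS (cylFn_mem_lowDeg S a) (!e) fun u hu => by
      rw [cylFn]
      split_ifs with hc
      · have := h u hc
        rw [hu] at this
        cases e <;> simp at this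
      · rfl
  have := congrFun h0 a
  rw [cylFn_apply_self] at this
  exact one_ne_zero this

/-- (C) HIDDEN LOSSES ARE HOLLOW. If a victim `P` never loses on the parity-NAND event (all its losses hide in the all-odd
coset), then its loss set contains no nonempty algebraic set of degree `< |T_j|/4` … -/
theorem hiddenLoss_no_levelSet {r : ℕ} {T : Fin r → Finset (Fin n)} (P : Fin n → Smolensky.CubeFn (ZMod 3) n)
    (hhide : ∀ y, ¬ RingHLF.Rel y (fun i => decide (P i y = 1)) → ∀ j, bpar (T j) y = true)
    (j : Fin r) {D : ℕ} (hD : 4 * D < (T j).card)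
    {G : Smolensky.CubeFn (ZMod 3) n} (hG : G ∈ Smolensky.lowDeg (ZMod 3) n D)
    (hsub : ∀ y, G y = 1 → ¬ RingHLF.Rel y (fun i => decide (P i y = 1))) : ∀ y, G y ≠ 1 :=
  levelSet_not_subset_parClass hD hG true fun y hy => hhide y (hsub y hy) j

/-- … and no cylinder of codimension `< |T_j|/2`, for ANY single block `j`. -/
theorem hiddenLoss_no_cylinder {r : ℕ} {T : Fin r → Finset (Fin n)} (P : Fin n → Smolensky.CubeFn (ZMod 3) n)
    (hhide : ∀ y, ¬ RingHLF.Rel y (fun i => decide (P i y = 1)) → ∀ j, bpar (T j) y = true)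
    (j : Fin r) {S : Finset (Fin n)} (hS : 2 * S.card < (T j).card) (a : Fin n → Bool) :
    ¬ ∀ y, (∀ i ∈ S, y i = a i) → ¬ RingHLF.Rel y (fun i => decide (P i y = 1)) :=
  fun h => cylinder_not_subset_parClass hS a true fun y hy => hhide y (h y hy) j

/-- ★ THE ROUGH RING IS HOLLOW (sharp no-shadow): on the `δ₀`-ring of length `8t`, for pairwise disjoint blocks with
`∏ |T_j| ≤ 4t` and `|T_j| > 4D`, ONE single-ring foreign strategy of degree `≤ r` has a win event (the parity-NAND event,
`Theorems.TameDial.exists_nand_ring`) that contains NO nonempty `𝔽₃`-algebraic set of degree `≤ D`. -/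
theorem roughRing_hollow {t : ℕ} (ht : 1 ≤ t) {r : ℕ} (T : Fin r → Finset (Fin (8 * t)))
    (hdis : ∀ j j', j ≠ j' → Disjoint (T j) (T j')) (hM : (∏ j, (T j).card) ≤ 4 * t) {D : ℕ} (hD : ∀ j, 4 * D < (T j).card) :
    ∃ Q : Fin (8 * t) → Smolensky.CubeFn (ZMod 3) (8 * t),
      (∀ i, Q i ∈ Smolensky.lowDeg (ZMod 3) (8 * t) r) ∧
      ∀ G : Smolensky.CubeFn (ZMod 3) (8 * t), G ∈ Smolensky.lowDeg (ZMod 3) (8 * t) D →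
        (∀ y, G y = 1 → RingHLF.Rel (Theorems.delta0 t) (fun i => decide (Q i y = 1))) → ∀ y, G y ≠ 1 := by
  obtain ⟨Q, hQ, hiff⟩ := Theorems.TameDial.exists_nand_ring ht T hM
  refine ⟨Q, hQ, fun G hG hsub => levelSet_not_subset_nandEv hdis hD hG fun y hy hall => ?_⟩
  have := (hiff y).1 (hsub y hy)
  exact this fun j => by simpa [bpar] using hall j

end Apps

end Summit.QuantumAdvantage.QuantumAdvantage.Theorems.HollowDial
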